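import Summits.AnomalousDissipation.AnomalousDissipation.Theorems.BaireTransferRobustLoudUpgradeStubLsSaddlePeriodicB
import Literature.Analysis.Calculus.BorderedSecondOrderIndefinite
import Literature.Analysis.FluidPDE.TimePeriodicNSLatticeLeibniz

/-!
# Stub `stub_lsSaddlePeriodic` of the line `malkin-cone-group-orbits` (crux stmt-AnomalousDissipation-1144, companion c3):
# THE INVISIBLE SADDLE OF CYCLES IS A ROBUST CROSSING (registered stub, Pi-form; periodic twin of c2's `stub_lsIndefinite`)

Assembly.  The free-period lattice map bordered by the phase functional `Re⟪g,·⟫` is run through `Calculus.malkin_implicit_family` with the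
ABSTRACT border `(Y_H, 0)` of a non-solvable admissible field `H` (as in `stub_lsFamilyPeriodic`); the cokernel functional `ψ`
(`Calculus.exists_cokernel_functional`) vanishes on `frc d` because the classical response `wd` of the INVISIBLE direction `d` is a lattice
response (`response_vec`, classical → lattice dictionary `TimePeriodicLattice.linear_lattice_of_classical`); along `(d, x)` the derivative of
the family runs through the line `−q_d + ℝ ĝ` (`lsSaddlePeriodic_partA/B`); realising `ĝ` and `−q_d` classically (`kernelField`,
`responseField`) the saddle hypothesis supplies solvable second-order problems with opposite multiples of `H`, which transported back
(`saddle_transfer`) give `ψ(B̂(ẑ,ẑ)) = −α < 0`, `−β > 0`: the second-order form on the fibre `{d} × ℝ` is INDEFINITE, and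
`Calculus.robustCrossing_of_indefinite` yields the sign change of `σ` at forces `c + s d → c`; zeros of `σ` are realised by `zeros_realised`.
Pure proof file; notations verbatim from `PeriodicNSOrbitPersistsProofs`.  Refs: Kielhöfer 2012 §I.16; Chow–Hale 1982 Ch. 7; Golubitsky–Schaeffer 1985 Ch. II.
-/


-- `Summit.<Summit>.<Problem>` is the tree's mandated summit-side namespace (CONVENTIONS §2); for this
-- single-conjunct summit the two coincide, so the duplicate is deliberate.
set_option linter.dupNamespace false

noncomputable section

open scoped BigOperators Topology ENNReal NNReal ComplexConjugate
open Filter Set Function MeasureTheory UnitAddTorus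

namespace Summit.AnomalousDissipation.AnomalousDissipation.Theorems.RobustLoudUpgrade.LsFamilyPeriodic

open Literature.Analysis.FunctionSpaces Literature.Analysis.FunctionSpaces.Torus
open Literature.Analysis.FunctionSpaces.EuclideanSpace
open Literature.Analysis.FluidPDE
open Literature.Analysis.FluidPDE.ScalarFourier
open Literature.Analysis.FluidPDE.TimePeriodicLattice
open Summit.AnomalousDissipation.AnomalousDissipation.Theses.BaireTransfer

-- NOTATION START (verbatim from `PeriodicNSOrbitPersistsProofs`)
/-- Local notation: the parabolic weight `Λ(n, k) = |n| + |k|²`. -/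
local notation:max "Λ" m:max => (|((Prod.fst m : ℤ) : ℝ)| + freqNormSq (Prod.snd m))

/-- Local notation: the convective symbol on `ℤ × ℤ³` (as in `TimePeriodicNSLattice`). -/
local notation:max "𝐍[" a ", " b "]" m:max =>
  (WithLp.toLp 2 (fun p : Fin 3 => ∑ j : Fin 3, ∑' m' : ℤ × (Fin 3 → ℤ),
    a m' j * (dsym j (Prod.snd m - Prod.snd m') * b (m - m') p)) : EuclideanSpace ℂ (Fin 3))

/-- Local notation: division by the weight. -/
local notation:max "𝐜" x:max => (fun mm : ℤ × (Fin 3 → ℤ) =>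
  ((((|((Prod.fst mm : ℤ) : ℝ)| + freqNormSq (Prod.snd mm))⁻¹ : ℝ) : ℂ) • x mm))

/-- Local notation: multiplication by the weight. -/
local notation:max "𝐬" x:max => (fun mm : ℤ × (Fin 3 → ℤ) =>
  ((((|((Prod.fst mm : ℤ) : ℝ)| + freqNormSq (Prod.snd mm)) : ℝ) : ℂ) • x mm))

/-- Local notation: the family of coefficients of `x ∈ W ⊂ ℓ²`. -/
local notation:max "𝐰" x:max =>
  (((x : lp (fun _ : ℤ × (Fin 3 → ℤ) => EuclideanSpace ℂ (Fin 3)) 2)) : ℤ × (Fin 3 → ℤ) → EuclideanSpace ℂ (Fin 3))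

/-- Local notation: the extension `K ↦ c (K₀, tail K)` of a lattice family to `ℤ⁴`. -/
local notation:max "𝐄" c:max => (fun K : Fin 4 → ℤ => c ((K 0, Fin.tail K) : ℤ × (Fin 3 → ℤ)))

/-- Local notation: the lattice family `û(n,k) = 𝓕(complexify ∘ (U − m₀))(n,k)`. -/
local notation:max "𝐮[" U ", " m₀ "]" => (fun mm : ℤ × (Fin 3 → ℤ) =>
  mFourierCoeff (EuclideanSpace.complexify ∘ fun y : UnitAddTorus (Fin 4) => U y - m₀)
    (Fin.cons (Prod.fst mm) (Prod.snd mm) : Fin 4 → ℤ))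

/-- Local notation: the force family `y_F(n,k) = [k ≠ 0][n = 0] 𝓕(complexify ∘ F)(k)`. -/
local notation:max "𝐲" F:max => (fun mm : ℤ × (Fin 3 → ℤ) =>
  (ite (Prod.snd mm = 0) (0 : EuclideanSpace ℂ (Fin 3))
    (ite (Prod.fst mm = 0) (mFourierCoeff (EuclideanSpace.complexify ∘ F) (Prod.snd mm)) 0)))

/-- Local notation: the lattice family of the orbit `u` with period `τ`. -/
local notation:max "𝐨[" τ ", " u "]" => (fun mm : ℤ × (Fin 3 → ℤ) =>
  mFourierCoeff (EuclideanSpace.complexify ∘ fun y : UnitAddTorus (Fin 4) => Torus.timeRoll τ u y - ∫ x, u 0 x)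
    (Fin.cons (Prod.fst mm) (Prod.snd mm) : Fin 4 → ℤ))
/-- Local notation: the time multiplier `dₛ(n,k) = 2πi n / Λ(n,k)`. -/
local notation "dS" => (fun mm : ℤ × (Fin 3 → ℤ) =>
  (2 * Real.pi * Complex.I * ((Prod.fst mm : ℤ) : ℂ)) * ((((|((Prod.fst mm : ℤ) : ℝ)| + freqNormSq (Prod.snd mm)) : ℝ) : ℂ))⁻¹)

/-- Local notation: the Stokes–drift multiplier `(4π²ν|k|² + 2πi m₀·k) / Λ(n,k)`. -/
local notation "dL[" ν ", " m₀ "]" => (fun mm : ℤ × (Fin 3 → ℤ) =>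
  (((4 * Real.pi ^ 2 * ν * freqNormSq (Prod.snd mm) : ℝ) : ℂ) +
      2 * Real.pi * Complex.I * (∑ jj : Fin 3, ((m₀ jj : ℝ) : ℂ) * (((Prod.snd mm) jj : ℤ) : ℂ))) *
    ((((|((Prod.fst mm : ℤ) : ℝ)| + freqNormSq (Prod.snd mm)) : ℝ) : ℂ))⁻¹)

/-- Local notation: the symbol `σ_om(n,k) = 2πiomn + 4π²ν|k|² + 2πi m₀·k`. -/
local notation "σ[" om ", " ν ", " m₀ "]" => (fun mm : ℤ × (Fin 3 → ℤ) =>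
  2 * Real.pi * Complex.I * ((om : ℝ) : ℂ) * ((Prod.fst mm : ℤ) : ℂ) +
    (((4 * Real.pi ^ 2 * ν * freqNormSq (Prod.snd mm) : ℝ)) : ℂ) +
    2 * Real.pi * Complex.I * (∑ jj : Fin 3, ((m₀ jj : ℝ) : ℂ) * (((Prod.snd mm) jj : ℤ) : ℂ)))
-- NOTATION END

variable {W : Submodule ℝ (lp (fun _ : ℤ × (Fin 3 → ℤ) => EuclideanSpace ℂ (Fin 3)) 2)}

/-! ## The registered stub -/

section Main

set_option maxHeartbeats 3200000 in
/-- **Registered stub `stub_lsSaddlePeriodic`** (companion c3): the invisible saddle of cycles is a robust crossing — see the module docstring.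
[folklore] -/
theorem stub_lsSaddlePeriodic : ∀ (S : Finset (Fin 3 → ℤ)) (c d : Coeff S) (ν τ : ℝ) (u : ℝ → UnitAddTorus (Fin 3) → EuclideanSpace ℝ (Fin 3)) (p : ℝ → UnitAddTorus (Fin 3) → ℝ) (v H wd : ℝ → UnitAddTorus (Fin 3) → EuclideanSpace ℝ (Fin 3)) (βd : ℝ), 0 < ν → 0 < τ → IsClassicalNSSolutionOn Set.univ ν (fun _ => force S c) u p → Function.Periodic u τ → (∃ t x, Torus.timeDerivWithin Set.univ u t x ≠ 0) → IsSmoothSpaceTimeOn Set.univ v → Function.Periodic v τ → (∀ t, IsDivFree (v t)) → (∀ t, HasZeroMean (v t)) → (¬ ∃ z : ℂ, ∀ t x, Torus.realToComplex (v t x) = z • velocityDot u t x) → (∀ (w : ℝ → UnitAddTorus (Fin 3) → EuclideanSpace ℂ (Fin 3)) (β : ℂ), w ∈ linPeriodicSol ν u τ (fun t x => β • velocityDot u t x) → ∃ z₁ z₂ : ℂ, ∀ t x, w t x = z₁ • velocityDot u t x + z₂ • Torus.realToComplex (v t x)) → IsSmoothSpaceTimeOn Set.univ H → Function.Periodic H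 τ → (∀ t, IsDivFree (H t)) → (∀ t, HasZeroMean (H t)) → (∀ β : ℂ, linPeriodicSol ν u τ (fun t x => β • velocityDot u t x + Torus.realToComplex (H t x)) = ∅) → IsSmoothSpaceTimeOn Set.univ wd → Function.Periodic wd τ → (∀ t, IsDivFree (wd t)) → (∀ t, HasZeroMean (wd t)) → (fun t x => Torus.realToComplex (wd t x)) ∈ linPeriodicSol ν u τ (fun t x => (βd : ℂ) • velocityDot u t x + cplx (force S d) x) → (∀ (wr we : ℝ → UnitAddTorus (Fin 3) → EuclideanSpace ℝ (Fin 3)) (β' βe : ℝ), IsSmoothSpaceTimeOn Set.univ wr → Function.Periodic wr τ → (fun t x => Torus.realToComplex (wr t x)) ∈ linPeriodicSol ν u τ (fun t x => (β' : ℂ) • velocityDot u t x) → (¬ ∃ z : ℂ, ∀ t x, Torus.realToComplex (wr t x) = z • velocityDot u t x) → IsSmoothSpaceTimeOn Set.univ we → Function.Periodic we τ → (fun t x => Torus.realToComplex (we t x)) ∈ linPeriodicSol ν u τ (fun t x => (βe : ℂ) • velocityDot u t x + cplx (force S d) x) → ∃ (lp lm α β βp βm : ℝ) (wp wm : ℝ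 → UnitAddTorus (Fin 3) → EuclideanSpace ℝ (Fin 3)), 0 < α ∧ β < 0 ∧ IsSmoothSpaceTimeOn Set.univ wp ∧ Function.Periodic wp τ ∧ (∀ t, IsDivFree (wp t)) ∧ (∀ t, HasZeroMean (wp t)) ∧ (fun t x => Torus.realToComplex (wp t x)) ∈ linPeriodicSol ν u τ (fun t x => (βp : ℂ) • velocityDot u t x + Torus.realToComplex (Torus.convect (fun y => we t y + lp • wr t y) (fun y => we t y + lp • wr t y) x - (βe + lp * β') • Torus.timeDerivWithin Set.univ (fun s y => we s y + lp • wr s y) t x + α • H t x)) ∧ IsSmoothSpaceTimeOn Set.univ wm ∧ Function.Periodic wm τ ∧ (∀ t, IsDivFree (wm t)) ∧ (∀ t, HasZeroMean (wm t)) ∧ (fun t x => Torus.realToComplex (wm t x)) ∈ linPeriodicSol ν u τ (fun t x => (βm : ℂ) • velocityDot u t x + Torus.realToComplex (Torus.convect (fun y => we t y + lm • wr t y) (fun y => we t y + lm • wr t y) x - (βe + lm * β') • Torus.timeDerivWithin Set.univ (fun s y => we s y + lm • wr s y) t x + β • H t x))) → ∃ σ : Coeff S × ℝ → ℝ, (∀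 δ : ℝ, 0 < δ → ∃ r : ℝ, 0 < r ∧ ContinuousOn σ (Metric.ball (c, (0 : ℝ)) r) ∧ ∀ q ∈ Metric.ball (c, (0 : ℝ)) r, σ q = 0 → ∃ (τ' : ℝ) (u' : ℝ → UnitAddTorus (Fin 3) → EuclideanSpace ℝ (Fin 3)) (p' : ℝ → UnitAddTorus (Fin 3) → ℝ), 0 < τ' ∧ IsClassicalNSSolutionOn Set.univ ν (fun _ => force S q.1) u' p' ∧ Function.Periodic u' τ' ∧ ∀ t, (∫ x, ‖u' t x - u (τ / τ' * t) x‖ ^ 2) + gradNormSq (fun x => u' t x - u (τ / τ' * t) x) ≤ δ) ∧ ∀ η : ℝ, 0 < η → ∃ (c₁ : Coeff S) (s₁ s₂ : ℝ), dist c₁ c < η ∧ |s₁| < η ∧ |s₂| < η ∧ σ (c₁, s₁) < 0 ∧ 0 < σ (c₁, s₂) := by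
  intro S c d ν τ u p v H wd βd hν hτ hsol hper hmov hsv hperv hvdiv hv0 hdeg hker hH hHper hHdiv hH0 hborder hswd hwdper hwddiv hwd0
    hresp hsaddle
  -- §1 the lattice set-up (verbatim `TimePeriodicLattice.persists_main`)
  obtain ⟨W, hW, hWc⟩ := exists_space
  haveI : CompleteSpace W := completeSpace_W hWc
  have hf : IsSmooth (force S c) := SteadyPersist.isSmooth_force' c
  have hfd : IsDivFree (force S c) := SteadyPersist.isDivFree_force' c
  have hf0 : HasZeroMean (force S c) := SteadyPersist.hasZeroMean_force' c
  have hU : IsSmooth (timeRoll τ u) := orbit_isSmooth hsol hper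
  have hu0 : ∀ n : ℤ, 𝐨[τ, u] ((n, 0) : ℤ × (Fin 3 → ℤ)) = 0 := orbit_zero_modes hsol hper hf0
  have hut := orbit_transversal hsol hper
  have huc := orbit_conj hsol hper
  have hur := orbit_rapidDecay hsol hper
  have hmomx₀ : ∀ N : ℕ, ∑' m : ℤ × (Fin 3 → ℤ), ENNReal.ofReal ((Λ m) ^ N) * ‖(𝐬 (𝐨[τ, u])) m‖ₑ ^ 2 ≠ ⊤ := fun N =>
    moments_of_rapidDecay (C := mFourierCoeff (complexify ∘ fun y => timeRoll τ u y - ∫ x, u 0 x)) hur N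
  have hx₀2 : ∑' m : ℤ × (Fin 3 → ℤ), ‖(𝐬 (𝐨[τ, u])) m‖ₑ ^ 2 ≠ ⊤ := by
    have := hmomx₀ 0; simpa only [pow_zero, ENNReal.ofReal_one, one_mul] using this
  obtain ⟨x₀, hx₀⟩ := exists_memW hW (v := 𝐬 (𝐨[τ, u])) hx₀2 (sw_zero_mode (x := 𝐨[τ, u]) hu0)
    (sw_transversal (x := 𝐨[τ, u]) hut) (sw_neg (x := 𝐨[τ, u]) huc)
  have hcx₀ : 𝐜 (𝐰 x₀) = 𝐨[τ, u] := by rw [hx₀]; exact cw_sw (x := 𝐨[τ, u]) hu0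
  have hg2 : ∑' m : ℤ × (Fin 3 → ℤ),
      ‖(fun mm : ℤ × (Fin 3 → ℤ) => (2 * Real.pi * Complex.I * (mm.1 : ℂ)) • (𝐬 (𝐨[τ, u])) mm) m‖ₑ ^ 2 ≠ ⊤ := by
    have h1 := tsum_enorm_nsmul_sq_le (𝐬 (𝐨[τ, u])) 0
    simp only [pow_zero, ENNReal.ofReal_one, one_mul, zero_add] at h1
    exact ne_top_of_le_ne_top (ENNReal.mul_ne_top ENNReal.ofReal_ne_top (hmomx₀ 2)) h1
  obtain ⟨g, hg⟩ := exists_memW hW (v := fun mm : ℤ × (Fin 3 → ℤ) => (2 * Real.pi * Complex.I * (mm.1 : ℂ)) • (𝐬 (𝐨[τ, u])) mm)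
    hg2 (nsmul_zero_mode (x := 𝐬 (𝐨[τ, u])) (sw_zero_mode (x := 𝐨[τ, u]) hu0))
    (nsmul_transversal (x := 𝐬 (𝐨[τ, u])) (sw_transversal (x := 𝐨[τ, u]) hut))
    (nsmul_neg (x := 𝐬 (𝐨[τ, u])) (sw_neg (x := 𝐨[τ, u]) huc))
  obtain ⟨Ds, hDs, -⟩ := exists_diag hW (d := dS) (M := 2 * Real.pi) norm_dS_le dS_neg
  obtain ⟨L₀, hL₀, -⟩ := exists_diag hW (d := dL[ν, ∫ x, u 0 x]) norm_dL_le dL_neg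
  obtain ⟨c₁, hc₁, hcl₁⟩ := exists_symbol_lower_bound (inv_pos.2 hτ) hν (∫ x, u 0 x)
  obtain ⟨J, hJ1, -, -, -⟩ := exists_diagEquiv hW (d := fun mm => ((τ⁻¹ : ℝ) : ℂ) * dS mm + dL[ν, ∫ x, u 0 x] mm)
    (norm_omega_dS_add_dL_le τ⁻¹) (omega_dS_add_dL_neg τ⁻¹) hc₁ (le_norm_omega_dS_add_dL hcl₁)
  have hJ : ∀ h : W, J h = τ⁻¹ • Ds h + L₀ h := fun h => W_ext fun m => by
    rw [hJ1, coeW_add, coeW_smul, Pi.add_apply, Pi.smul_apply, hDs, hL₀, ← Complex.coe_smul, smul_smul, ← add_smul]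
  obtain ⟨B, hBf, hBb⟩ := exists_bilinear hW
  obtain ⟨K, hK'⟩ : ∃ K : W →L[ℝ] W, ∀ w, K w = B x₀ w + B w x₀ :=
    ⟨(hBb.deriv (x₀, x₀)).comp ((ContinuousLinearMap.id ℝ W).prod (ContinuousLinearMap.id ℝ W)), fun w => by
      simp [IsBoundedBilinearMap.deriv_apply]⟩
  have hx₀w : ∑' m : ℤ × (Fin 3 → ℤ), ENNReal.ofReal ((1 + Λ m) * sobolevWeight 1 m.2) * ‖(𝐜 (𝐰 x₀)) m‖ₑ ≠ ⊤ := by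
    rw [hcx₀]; exact tsum_wt_weight_enorm_ne_top_of_rapidDecay hur
  have hKc : IsCompactOperator K := isCompactOperator_linearised hW hWc hBf x₀ hx₀w K hK'
  -- §2 the force map and the state vector of `v`; the base-point equation
  obtain ⟨Fm, hFm⟩ := exists_forceMapST hW S
  obtain ⟨kv, hkv⟩ := exists_fieldVecW hW hsv hperv hvdiv hv0
  have hy0 : τ⁻¹ • Ds x₀ + L₀ x₀ + B x₀ x₀ = Fm c := by
    refine W_ext fun m => ?_
    by_cases hm : m.2 = 0
    · rw [W_zero' hW _ hm, W_zero' hW _ hm]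
    · rw [coord_G hDs hL₀ hBf x₀ τ⁻¹ m, hFm, hcx₀, yf_of_snd_ne_zero (force S c) hm]
      exact orbit_equation hsol hper hτ hfd m hm
  obtain ⟨YH, hYH⟩ := exists_fieldVec hW hH hHper hHdiv hH0
  -- §3 `g ≠ 0`, `∂ₛx₀ ≠ 0`; the phase functional `Re⟪g,·⟫`; `T g = 0`
  obtain ⟨hg0, hDs0⟩ := phase_ne_zero hDs hτ hsol hper hf0 hmov hsv hperv hdeg x₀ hx₀ g hg
  have hgx : ∀ m : ℤ × (Fin 3 → ℤ), (𝐰 g) m = (2 * Real.pi * Complex.I * (m.1 : ℂ)) • (𝐰 x₀) m := fun m => by rw [hg, hx₀]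
  obtain ⟨φ, hφg, hφx₀, -⟩ := exists_phaseFunctional g x₀ hgx
  have hφ : φ g ≠ 0 := by rw [hφg]; exact pow_ne_zero 2 (norm_ne_zero_iff.2 hg0)
  have hTg0 : τ⁻¹ • Ds g + L₀ g + (B x₀ g + B g x₀) = 0 := phase_mem_ker hW hDs hL₀ hBf hτ hsol hper hf0 hfd x₀ hx₀ g hg
  -- §4 the bordered free-period map: linearisation, compactness, quadratic structure
  set T : W →L[ℝ] W := (J : W →L[ℝ] W) + K with hT
  have hTx : ∀ h, T h = J h + K h := fun h => rfl
  obtain ⟨G', hG', hG'x⟩ := exists_hasStrictFDerivAt_periodicMap Ds L₀ hBb x₀ τ⁻¹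
  set Th : (W × ℝ) →L[ℝ] (W × ℝ) := G'.prod (φ.comp (ContinuousLinearMap.fst ℝ W ℝ)) with hTh
  have hThx : ∀ q : W × ℝ, Th q = (T q.1 + q.2 • Ds x₀, φ q.1) := by
    rintro ⟨h, μ⟩
    refine Prod.ext ?_ ?_
    · simp only [hTh, ContinuousLinearMap.prod_apply, hG'x, hTx, hJ, hK']
      abel
    · simp [hTh]
  set Jh : (W × ℝ) ≃L[ℝ] (W × ℝ) := J.prodCongr (ContinuousLinearEquiv.refl ℝ ℝ) with hJh
  have hThe : Th = (((T.comp (ContinuousLinearMap.fst ℝ W ℝ) + (ContinuousLinearMap.snd ℝ W ℝ).smulRight (Ds x₀)).prod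
      (φ.comp (ContinuousLinearMap.fst ℝ W ℝ)))) := by
    refine ContinuousLinearMap.ext fun q => ?_
    rw [hThx]
    obtain ⟨h, μ⟩ := q
    simp
  have hcomp : IsCompactOperator ((Th - (Jh : (W × ℝ) →L[ℝ] (W × ℝ)) : (W × ℝ) →L[ℝ] (W × ℝ))) := by
    rw [hThe, hJh, hT]
    exact lsFamilyPeriodic_partC W J K (Ds x₀) φ hKc
  obtain ⟨Bh, hBh⟩ := lsFamilyPeriodic_partD W Ds B hBb
  set Ah : (W × ℝ) →L[ℝ] (W × ℝ) := (L₀.comp (ContinuousLinearMap.fst ℝ W ℝ)).prod (φ.comp (ContinuousLinearMap.fst ℝ W ℝ)) with hAh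
  set Nh : W × ℝ → W × ℝ := fun q => (q.2 • Ds q.1 + L₀ q.1 + B q.1 q.1, φ q.1) with hNh
  have hNq : ∀ q : W × ℝ, Nh q = Ah q + Bh q q := fun q => quadratic_form_periodicMap Ds L₀ B φ Bh hBh q
  have hThA : ∀ w : W × ℝ, Th w = Ah w + Bh (x₀, τ⁻¹) w + Bh w (x₀, τ⁻¹) := by
    rintro ⟨h, μ⟩
    rw [hThx, hBh, hBh]
    simp only [hAh, ContinuousLinearMap.prod_apply, ContinuousLinearMap.comp_apply, ContinuousLinearMap.coe_fst', Prod.mk_add_mk,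
      add_zero, hTx, hJ, hK']
    refine Prod.ext ?_ rfl
    simp only
    abel
  set frc : Coeff S →L[ℝ] (W × ℝ) := (-Fm).prod (0 : Coeff S →L[ℝ] ℝ) with hfrc
  have hfrcx : ∀ d' : Coeff S, frc d' = (-(Fm d'), 0) := fun d' => by simp [hfrc]
  have h0 : Nh (x₀, τ⁻¹) + frc c = 0 := by
    rw [hfrcx]
    simp only [hNh, Prod.mk_add_mk, add_zero, hy0, add_neg_cancel, hφx₀, Prod.mk_zero_zero]
  have h0' : Ah (x₀, τ⁻¹) + Bh (x₀, τ⁻¹) (x₀, τ⁻¹) + frc c = 0 := by rw [← hNq]; exact h0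
  have hNd : HasFDerivAt Nh Th (x₀, τ⁻¹) := by
    have h2 : HasFDerivAt (fun q : W × ℝ => φ q.1) (φ.comp (ContinuousLinearMap.fst ℝ W ℝ)) (x₀, τ⁻¹) :=
      φ.hasFDerivAt.comp (x₀, τ⁻¹) hasFDerivAt_fst
    exact hG'.hasFDerivAt.prodMk h2
  have hNc : ContDiffAt ℝ 1 Nh (x₀, τ⁻¹) := by
    have h1 : ContDiff ℝ 1 (fun q : W × ℝ => q.2 • Ds q.1) := by
      have ha : ContDiff ℝ 1 (fun q : W × ℝ => q.2) := contDiff_snd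
      have hb : ContDiff ℝ 1 (fun q : W × ℝ => Ds q.1) := Ds.contDiff.comp contDiff_fst
      exact ha.smul hb
    have h2 : ContDiff ℝ 1 (fun q : W × ℝ => L₀ q.1) := L₀.contDiff.comp contDiff_fst
    have h3 : ContDiff ℝ 1 (fun q : W × ℝ => B q.1 q.1) :=
      (hBb.contDiff.comp ((contDiff_fst (E := W) (F := ℝ)).prodMk (contDiff_fst (E := W) (F := ℝ))) :)
    have h4 : ContDiff ℝ 1 (fun q : W × ℝ => φ q.1) := φ.contDiff.comp contDiff_fst
    exact (((h1.add h2).add h3).prodMk h4).contDiffAt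
  have hTg : T g = 0 := by rw [hTx, hJ, hK']; exact hTg0
  -- §5 the abstract border `(Y_H, 0)` is not in the range; the kernel is a line
  have heh : ∀ (h : W) (μ : ℝ), T h + μ • Ds x₀ = YH → False := by
    intro h μ hq
    have heqW : τ⁻¹ • Ds h + L₀ h + (B x₀ h + B h x₀) = (-μ) • Ds x₀ + YH := by
      rw [← hJ h, ← hK' h, ← hTx, ← hq, neg_smul]; abel
    obtain ⟨w, hw⟩ := forced_classical hW hDs hL₀ hBf hν hτ hsol hper hf0 x₀ hx₀ hH hHper hHdiv hH0 YH hYH h μ heqW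
    have := hborder (((-μ : ℝ) : ℂ) * (τ : ℂ))
    rw [Set.eq_empty_iff_forall_notMem] at this
    exact this w hw
  have hrange : ∀ q : W × ℝ, Th q ≠ ((YH, 0) : W × ℝ) := by
    rintro ⟨h, μ⟩ hq
    rw [hThx] at hq
    exact heh h μ (congrArg Prod.fst hq)
  have hninj : ¬ Function.Injective Th := fun hi =>
    hrange _ (Classical.choose_spec ((Literature.Analysis.Calculus.bijective_of_injective_of_isCompactOperator Th Jh hcomp hi).2 ((YH, 0) : W × ℝ)))
  obtain ⟨gh, hghT, hgh0⟩ : ∃ q : W × ℝ, Th q = 0 ∧ q ≠ 0 := by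
    by_contra hcon
    push Not at hcon
    exact hninj ((injective_iff_map_eq_zero Th).2 hcon)
  have hdec : ∀ (h : W) (μ : ℝ), T h + μ • Ds x₀ = 0 → ∃ a b : ℝ, h = a • g + b • kv := by
    intro h μ hq
    have heqW : τ⁻¹ • Ds h + L₀ h + (B x₀ h + B h x₀) = (-μ) • Ds x₀ := by
      rw [← hJ h, ← hK' h, ← hTx, neg_smul, eq_neg_iff_add_eq_zero, hq]
    exact ker_decomp hW hDs hL₀ hBf hν hτ hsol hper hf0 hmov hsv hperv hvdiv hv0 hdeg hker x₀ hx₀ g hg kv hkv h μ heqW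
  have hghT1 : T gh.1 + gh.2 • Ds x₀ = 0 := by
    have := congrArg Prod.fst (hThx gh); rw [hghT] at this; exact this.symm
  have hφgh : φ gh.1 = 0 := by have := congrArg Prod.snd (hThx gh); rw [hghT] at this; exact this.symm
  have hker' : ∀ q : W × ℝ, Th q = 0 → ∃ z : ℝ, q = z • gh := by
    intro q hq
    have hq1 : T q.1 + q.2 • Ds x₀ = 0 := by have := congrArg Prod.fst (hThx q); rw [hq] at this; exact this.symm
    have hq2 : φ q.1 = 0 := by have := congrArg Prod.snd (hThx q); rw [hq] at this; exact this.symm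
    exact lsFamilyPeriodic_partB W (T : W →ₗ[ℝ] W) (φ : W →ₗ[ℝ] ℝ) (Ds x₀) g kv gh hDs0 hφ
      (fun h μ hh => hdec h μ hh) hghT1 hφgh hgh0 q hq1 hq2
  obtain ⟨φ₂, -, hφ₂g⟩ := exists_dual_vector ℝ gh (norm_ne_zero_iff.2 hgh0)
  have hφ₂ : φ₂ gh ≠ 0 := by rw [hφ₂g]; exact_mod_cast norm_ne_zero_iff.2 hgh0
  -- §6 the Malkin implicit family with the abstract border
  obtain ⟨σ, υ, ℓ, r, hr, -, hυ0, hσℓ, -, hυd, -, -, hσc, hυc, hsolq, -⟩ :=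
    Literature.Analysis.Calculus.malkin_implicit_family Nh frc Th Jh φ₂ (x₀, τ⁻¹) gh c ((YH, 0) : W × ℝ) hNc hNd h0 hcomp hker' hrange hφ₂
  refine ⟨σ, ?_, fun η hη => ?_⟩
  · -- §7 zeros of `σ` are periodic orbits of the uncorrected forces, uniformly close to `u`
    refine zeros_realised hW hDs hL₀ hBf hν hτ hsol hper hf0 x₀ hx₀ Fm hFm υ σ c r hr hυ0 hυc hσc fun q hq hσq => ?_
    obtain ⟨hNq', -⟩ := hsolq q hq
    rw [hσq, zero_smul, sub_zero, hfrcx] at hNq'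
    have h1 := congrArg Prod.fst hNq'
    simp only [hNh, Prod.mk_add_mk, Prod.fst_zero] at h1
    rw [← sub_eq_zero, ← h1]
    abel
  · -- §8 the invisible saddle
    have hD : Function.Bijective fun q : (W × ℝ) × ℝ => (Th q.1 - q.2 • ((YH, 0) : W × ℝ), φ₂ q.1) :=
      Literature.Analysis.Calculus.bordered_bijective Th Jh hcomp gh ((YH, 0) : W × ℝ) φ₂ hker' hrange hφ₂
    obtain ⟨ψ, hψT, hψe, hψker⟩ := Literature.Analysis.Calculus.exists_cokernel_functional Th φ₂ ((YH, 0) : W × ℝ) hD hrange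
    obtain ⟨Dυ, hDυ⟩ : ∃ D : Coeff S × ℝ →L[ℝ] (W × ℝ), D = fderiv ℝ υ (c, 0) := ⟨_, rfl⟩
    have hυd' : HasFDerivAt υ Dυ (c, 0) := by rw [hDυ]; exact (hυd.differentiableAt (by norm_num)).hasFDerivAt
    have hder := lsSaddlePeriodic_partA (W × ℝ) (W × ℝ) (Coeff S) Nh Th frc ((YH, 0) : W × ℝ) φ₂ σ υ ℓ Dυ (x₀, τ⁻¹) c r hNd hυ0 hσℓ
      hυd' hr hsolq
    -- `ψ (0, 1) = 0`: the vertical vector is `T̂ (g / φ g, 0)`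
    have hψ01 : ψ ((0, 1) : W × ℝ) = 0 := by
      have h1 : Th ((((φ g)⁻¹ • g), 0) : W × ℝ) = ((0, 1) : W × ℝ) := by
        rw [hThx]
        refine Prod.ext ?_ ?_
        · simp only [map_smul, hTg, smul_zero, zero_smul, add_zero]
        · simp only [map_smul, smul_eq_mul, inv_mul_cancel₀ hφ]
      rw [← h1]; exact hψT _
    -- the lattice response of the invisible direction, from the classical response `wd`
    have hFmD : 𝐰 (Fm d) = 𝐮[timeRoll τ (fun _ : ℝ => force S d), 0] := by
      rw [hFm]; exact yf_eq_constField τ (SteadyPersist.isSmooth_force' d) (SteadyPersist.hasZeroMean_force' d)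
    obtain ⟨kd, hkd⟩ := response_vec hW hDs hL₀ hBf hτ hsol hper hf0 x₀ hx₀ Fm hFm d βd hswd hwdper hwddiv hwd0 hresp
    set qd : W × ℝ := ((-kd + ((φ kd) * (φ g)⁻¹) • g, βd * τ⁻¹) : W × ℝ) with hqd
    have hTkd : T kd = (βd * τ⁻¹) • Ds x₀ + Fm d := by rw [hTx, hJ, hK']; exact hkd
    have hThqd : Th qd = frc d := by
      rw [hThx, hfrcx]
      refine Prod.ext ?_ ?_
      · simp only [hqd, map_add, map_neg, map_smul, hTkd, hTg, smul_zero, add_zero]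
        abel
      · simp only [hqd, map_add, map_neg, map_smul, smul_eq_mul, inv_mul_cancel_right₀ hφ]
        abel
    obtain ⟨hd0, hDυ⟩ := lsSaddlePeriodic_partB (W × ℝ) (W × ℝ) (Coeff S) Th frc ((YH, 0) : W × ℝ) ψ φ₂ ℓ Dυ gh qd d hψT hψe hker' hφ₂
      hder hThqd
    -- the kernel pair and the response pair, realised classically
    have hkeq : τ⁻¹ • Ds gh.1 + L₀ gh.1 + (B x₀ gh.1 + B gh.1 x₀) = (-gh.2) • Ds x₀ := by
      rw [← hJ gh.1, ← hK' gh.1, ← hTx, neg_smul, eq_neg_iff_add_eq_zero, hghT1]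
    obtain ⟨hhr₁, -, hrealr, -, hwrs, hwrper, hwrmem⟩ := kernelField hW hDs hL₀ hBf hν hτ hsol hper hf0 x₀ hx₀ gh.1 gh.2 hkeq
    have hkn : ¬ ∃ z' : ℂ, ∀ t x, Torus.realToComplex (EuclideanSpace.realPart (fourierSynth (𝐄 (𝐜 (𝐰 gh.1)))
        (Fin.cons (((τ⁻¹ * t : ℝ)) : UnitAddCircle) x))) = z' • velocityDot u t x := by
      rintro ⟨z', hz'⟩
      have hz'' : ∀ t x, fourierSynth (𝐄 (𝐜 (𝐰 gh.1))) (Fin.cons (((τ⁻¹ * t : ℝ)) : UnitAddCircle) x) =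
          z' • Torus.realToComplex (Torus.timeDerivWithin univ u t x) := by
        intro t x
        have h2 := congrArg (fun F : UnitAddTorus (Fin 4) → EuclideanSpace ℂ (Fin 3) => F (Fin.cons (((τ⁻¹ * t : ℝ)) : UnitAddCircle) x)) hrealr
        simp only [Function.comp_apply] at h2
        rw [← h2, ← SteadyLattice.realToComplex_eq_complexify]
        exact hz' t x
      have hg1 : gh.1 = 0 := kernel_not_phase hW hτ hsol.smooth_velocity hper g hg hg0 φ hφ gh.1 hhr₁ hφgh hz''
      have hg2' : gh.2 = 0 := by
        have h1 := hghT1; rw [hg1, map_zero, zero_add] at h1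
        rcases smul_eq_zero.1 h1 with h2 | h2
        · exact h2
        · exact absurd h2 hDs0
      exact hgh0 (Prod.ext hg1 hg2')
    have heqe : τ⁻¹ • Ds (kd - ((φ kd) * (φ g)⁻¹) • g) + L₀ (kd - ((φ kd) * (φ g)⁻¹) • g) +
        (B x₀ (kd - ((φ kd) * (φ g)⁻¹) • g) + B (kd - ((φ kd) * (φ g)⁻¹) • g) x₀) = (-(-(βd * τ⁻¹))) • Ds x₀ + Fm d := by
      have e1 : T (kd - ((φ kd) * (φ g)⁻¹) • g) = (βd * τ⁻¹) • Ds x₀ + Fm d := by rw [map_sub, map_smul, hTg, smul_zero, sub_zero, hTkd]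
      rw [hTx, hJ, hK'] at e1
      rw [neg_neg]; exact e1
    obtain ⟨-, -, -, -, hwes, hweper, hwemem⟩ := responseField hW hDs hL₀ hBf hν hτ hsol hper hf0 x₀ hx₀ (H := fun _ : ℝ => force S d)
      (isSmoothSpaceTimeOn_const (SteadyPersist.isSmooth_force' d) univ) (fun t => rfl)
      (fun _ => SteadyPersist.isDivFree_force' d) (fun _ => SteadyPersist.hasZeroMean_force' d) (Fm d) hFmD
      (kd - ((φ kd) * (φ g)⁻¹) • g) (-(βd * τ⁻¹)) heqe
    -- the saddle hypothesis, applied to this kernel pair and this response pair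
    obtain ⟨lp, lm, α, β, βp, βm, wp, wm, hα, hβ, hswp, hwpper, hwpdiv, hwp0, hmemp, hswm, hwmper, hwmdiv, hwm0, hmemm⟩ :=
      hsaddle _ _ ((-gh.2) * τ) ((-(-(βd * τ⁻¹))) * τ) hwrs hwrper (by
        have := hwrmem
        simp only [Complex.ofReal_mul, Complex.ofReal_neg] at this ⊢
        exact this) hkn hwes hweper (by
        have := hwemem
        simp only [Complex.ofReal_mul, Complex.ofReal_neg] at this ⊢
        exact this)
    -- transported back: the second-order form takes both signs on the fibre `{d} × ℝ`
    have hvals : ∀ (l' α' βq : ℝ) (wq : ℝ → UnitAddTorus (Fin 3) → EuclideanSpace ℝ (Fin 3)), IsSmoothSpaceTimeOn univ wq →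
        Function.Periodic wq τ → (∀ t, IsDivFree (wq t)) → (∀ t, HasZeroMean (wq t)) →
        (fun t x => Torus.realToComplex (wq t x)) ∈ linPeriodicSol ν u τ (fun t x => (βq : ℂ) • velocityDot u t x +
          Torus.realToComplex (Torus.convect
            (fun y => EuclideanSpace.realPart (fourierSynth (𝐄 (𝐜 (𝐰 (kd - ((φ kd) * (φ g)⁻¹) • g)))) (Fin.cons (((τ⁻¹ * t : ℝ)) : UnitAddCircle) y)) +
              l' • EuclideanSpace.realPart (fourierSynth (𝐄 (𝐜 (𝐰 gh.1))) (Fin.cons (((τ⁻¹ * t : ℝ)) : UnitAddCircle) y)))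
            (fun y => EuclideanSpace.realPart (fourierSynth (𝐄 (𝐜 (𝐰 (kd - ((φ kd) * (φ g)⁻¹) • g)))) (Fin.cons (((τ⁻¹ * t : ℝ)) : UnitAddCircle) y)) +
              l' • EuclideanSpace.realPart (fourierSynth (𝐄 (𝐜 (𝐰 gh.1))) (Fin.cons (((τ⁻¹ * t : ℝ)) : UnitAddCircle) y))) x -
            ((-(-(βd * τ⁻¹))) * τ + l' * ((-gh.2) * τ)) • Torus.timeDerivWithin univ (fun s y =>
              EuclideanSpace.realPart (fourierSynth (𝐄 (𝐜 (𝐰 (kd - ((φ kd) * (φ g)⁻¹) • g)))) (Fin.cons (((τ⁻¹ * s : ℝ)) : UnitAddCircle) y)) +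
              l' • EuclideanSpace.realPart (fourierSynth (𝐄 (𝐜 (𝐰 gh.1))) (Fin.cons (((τ⁻¹ * s : ℝ)) : UnitAddCircle) y))) t x +
            α' • H t x)) →
        ψ (Bh (Dυ (d, l' * φ₂ gh - φ₂ qd)) (Dυ (d, l' * φ₂ gh - φ₂ qd))) = -α' := by
      intro l' α' βq wq hswq hwqper hwqdiv hwq0 hmemq
      obtain ⟨kp, hkp⟩ := saddle_transfer hW hDs hL₀ hBf hν hτ hsol hper hf0 x₀ hx₀ hH hHper hHdiv hH0 YH hYH
        (D := fun _ : ℝ => force S d) (isSmoothSpaceTimeOn_const (SteadyPersist.isSmooth_force' d) univ) (fun t => rfl)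
        (fun _ => SteadyPersist.isDivFree_force' d) (fun _ => SteadyPersist.hasZeroMean_force' d) (Fm d) hFmD
        (kd - ((φ kd) * (φ g)⁻¹) • g) (-(βd * τ⁻¹)) heqe gh.1 gh.2 hkeq l' α' βq hswq hwqper hwqdiv hwq0 hmemq
      have hz : Dυ (d, l' * φ₂ gh - φ₂ qd) = -qd + l' • gh := hDυ l'
      have hpair : -qd + l' • gh = ((kd - ((φ kd) * (φ g)⁻¹) • g + l' • gh.1, (-(βd * τ⁻¹)) + l' * gh.2) : W × ℝ) := by
        refine Prod.ext ?_ ?_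
        · simp only [hqd, Prod.fst_add, Prod.fst_neg, Prod.smul_fst, neg_add_rev, neg_neg, sub_eq_add_neg]
          abel
        · simp only [hqd, Prod.snd_add, Prod.snd_neg, Prod.smul_snd, smul_eq_mul]
      have hTkp : T kp = (βq * τ⁻¹) • Ds x₀ + (((-(βd * τ⁻¹)) + l' * gh.2) • Ds (kd - ((φ kd) * (φ g)⁻¹) • g + l' • gh.1) +
          B (kd - ((φ kd) * (φ g)⁻¹) • g + l' • gh.1) (kd - ((φ kd) * (φ g)⁻¹) • g + l' • gh.1)) + α' • YH := by
        rw [hTx, hJ, hK']; exact hkp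
      have hX : Th ((kp, -(βq * τ⁻¹)) : W × ℝ) =
          Bh (-qd + l' • gh) (-qd + l' • gh) + α' • ((YH, 0) : W × ℝ) + (φ kp) • ((0, 1) : W × ℝ) := by
        rw [hpair, hBh, hThx, hTkp]
        refine Prod.ext ?_ ?_
        · simp only [Prod.fst_add, Prod.smul_fst, smul_zero, add_zero, neg_smul]
          abel
        · simp only [Prod.snd_add, Prod.smul_snd, zero_add, smul_eq_mul, mul_one, mul_zero]
      have e2 : ψ (α' • ((YH, 0) : W × ℝ)) = α' := by rw [ψ.map_smul, hψe, smul_eq_mul, mul_one]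
      have e3 : ψ ((φ kp) • ((0, 1) : W × ℝ)) = 0 := by rw [ψ.map_smul, hψ01, smul_zero]
      have h1 := hψT ((kp, -(βq * τ⁻¹)) : W × ℝ)
      rw [hX, ψ.map_add, ψ.map_add, e2, e3, add_zero] at h1
      rw [hz]
      linarith
    have hneg : ψ (Bh (Dυ (d, lp * φ₂ gh - φ₂ qd)) (Dυ (d, lp * φ₂ gh - φ₂ qd))) < 0 := by
      rw [hvals lp α βp wp hswp hwpper hwpdiv hwp0 hmemp]; linarith
    have hpos : 0 < ψ (Bh (Dυ (d, lm * φ₂ gh - φ₂ qd)) (Dυ (d, lm * φ₂ gh - φ₂ qd))) := by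
      rw [hvals lm β βm wm hswm hwmper hwmdiv hwm0 hmemm]; linarith
    have hsol' : ∀ q ∈ Metric.ball ((c, 0) : Coeff S × ℝ) r, Ah (υ q) + Bh (υ q) (υ q) + frc q.1 - σ q • ((YH, 0) : W × ℝ) = 0 := by
      intro q hq
      rw [← hNq]
      exact (hsolq q hq).1
    obtain ⟨s, x₁, x₂, hdist, hx₁, hx₂, -, -, hσ₁, hσ₂⟩ := Literature.Analysis.Calculus.robustCrossing_of_indefinite Ah Bh Th frc
      (x₀, τ⁻¹) c ((YH, 0) : W × ℝ) ψ σ υ Dυ r hThA hψT hψe h0' hr hυ0 hυd' hsol' d hd0 _ _ hpos hneg η hη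
    exact ⟨c + s • d, x₁, x₂, hdist, hx₁, hx₂, hσ₁, hσ₂⟩

end Main

end Summit.AnomalousDissipation.AnomalousDissipation.Theorems.RobustLoudUpgrade.LsFamilyPeriodic

end
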